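import Mathlib.Analysis.Calculus.BumpFunction.Convolution
import Literature.Analysis.FluidPDE.PressureRepresentation
import Literature.Analysis.FunctionSpaces.MollificationLp
import HarnessLib

/-!
# The duality/dilation bound for the normalised pressure of a `C¹` field

Discharge of `Literature.Analysis.FluidPDE.integral_normalisedPressure_mul_rescaled_le`.

Sibling of `FluidPDE/NormalisedPressureProofs` (the decomposition of Tao's pressure-normalisation
lemma, Tao 2011 = arXiv:1108.1165, Lemma 4.1 (i), into the inputs F0–F4). Input **F2**,
`Literature.Analysis.FluidPDE.integral_normalisedPressure_mul_rescaled_le`, is the scale-free form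
of the sentence of the printed proof (§4, proof of Lemma 4.1 (i), arXiv p. 15): "by an
integration by parts and (p0-def), we can express `R⁻³∫∫ ∇p₀ χ(x/R)` as
`R⁻⁴ ∫∫ uᵢuⱼ (∇Δ⁻¹∂ᵢ∂ⱼχ)(x/R) + …`. From the finite energy nature of `(u,p,u₀,f,T)` we see that
this expression goes to zero as `R → ∞`": for every test function `ψ ∈ C_c^∞(ℝ³)` there is a
constant `M` such that for every `C¹` field `v` of finite energy, every centre `x₀` and every
scale `R > 0`,

  `|∫ p̃[v](x) ψ(R⁻¹(x - x₀)) dx| ≤ M ∫|v|²`,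

`p̃[v] = -|v|²/3 + p.v.∫ K(· - y)(v y) dy` the normalised (Riesz-transform) pressure of
`FluidPDE/NormalisedPressure`. This file PROVES it
(`integral_normalisedPressure_mul_rescaled_le_holds`, end of file); it is a separate module
because `NormalisedPressureProofs` is upstream of `NormalisedPressurePV` and
`PressureRepresentation`, whose results are used here. With F0, F1, F1b, F3, F4 already
discharged (`NormalisedPressureDischarge`, `NormalisedPressurePV`, `NSFiniteEnergySmoothProofs`,
`HarmonicMeanValue`), all five inputs of `NormalisedPressureProofs` are now theorems.

## The argument

The tree proves the bound for `C²` fields: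
`PressureRepresentation.abs_integral_pressurePotential_mul_le`
(duality against the near/far splitting `Q[v] = -(Γ₀ * ∂ᵢ∂ⱼ(vᵢvⱼ)) - (D²Γ∞) * (v ⊗ v)` of the
Newtonian potential, two integrations by parts and the dilation laws — Tao's computation) together
with `normalisedPressure_eq_pressurePotential'` (`p̃[v] = Q[v]` for `v ∈ C²`, `|v|² ∈ L¹`). The
fact is stated for `C¹` fields (the class on which the principal values exist,
`NormalisedPressurePV.hasPressurePV_of_contDiff_holds`), so we close the gap by mollification:

* §3 `φₙ ⋆ v` (Mathlib's `ContDiffBump.normed` kernels, `rOut = 1/(n+1)`) is smooth, does not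
  increase the energy (`∫|φₙ ⋆ v|² ≤ ∫|v|²`, Young's inequality from
  `FunctionSpaces/Mollification`), inherits the local sup and Lipschitz bounds of `v`
  (probability kernel; mean value inequality under the integral), converges to `v` pointwise
  (Mathlib) and in `L²` (`FunctionSpaces/MollificationLp`);
* §2 the principal value of any `C¹` finite-energy `w` is within `8M₀M₁ε` of its
  `ε`-truncation (the Cauchy estimate `abs_truncatedPressureIntegral_sub_le` of
  `NormalisedPressurePV` passed to the limit), whence the uniform bound
  `|p̃[w](x)| ≤ M₀²/3 + 8M₀M₁ + ∫|w|²/(2π)` (far field `|K(z)(a)| ≤ |a|²/(2π|z|³)`);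
* §4 for fixed `ε` the `ε`-truncations of `φₙ ⋆ v` converge to that of `v`
  (`|K(z)(b) - K(z)(a)| ≤ (|a|+|b|)|b-a|/(π|z|³)`, `L²` convergence, weighted AM–GM);
* §5 hence `p̃[φₙ ⋆ v](x) → p̃[v](x)` at every point (a `3ε` argument), with a bound uniform on
  compact sets;
* §6 dominated convergence on the support of `ψ(R⁻¹(· - x₀))` passes the `C²` bound
  `|∫ p̃[φₙ ⋆ v] ψ_R| ≤ M ∫|φₙ ⋆ v|² ≤ M ∫|v|²` to the limit (with `max M 0`, which only
  enlarges the constant).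

No new definitions; the constant is the one of the `C²` theory.

## Mathlib / tree search

Mathlib: `ContDiffBump.normed`, `HasCompactSupport.contDiff_convolution_left`,
`dist_convolution_le`, `ContDiffBump.convolution_tendsto_right_of_continuous`,
`Convex.norm_image_sub_le_of_norm_fderiv_le`, `tendsto_integral_of_dominated_convergence`,
`eLpNorm_nnreal_pow_eq_lintegral` (all used); no singular-integral / Riesz-transform theory
(`lean search 'rieszTransform|singularIntegral|HasPressurePV'`: only the tree). Tree:
`abs_integral_pressurePotential_mul_le`, `normalisedPressure_eq_pressurePotential'`,
`contDiff_pressurePotential`, `hasCompactSupport_comp_inv_smul_sub` (`PressureRepresentation`);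
`abs_truncatedPressureIntegral_sub_le`, `integrableOn_pressureKernel_compl_closedBall`,
`abs_pressureKernel_sub_le`, `normalisedPressure_eq_of_contDiff` (`NormalisedPressurePV`);
`abs_pressureKernel_le` (`TaoEnergyLocalisationPressure`);
`integrable_sq_of_lintegral_enorm_sq_lt_top`, `ofReal_integral_norm_sq_eq_lintegral`
(`TaoEnergyLocalisation`); `FunctionSpaces.eLpNorm_normed_convolution_le`,
`FunctionSpaces.memLp_normed_convolution` (`FunctionSpaces/Mollification`),
`FunctionSpaces.tendsto_eLpNorm_normed_convolution_sub_self` (`FunctionSpaces/MollificationLp`).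

## References

* T. Tao, *Localisation and compactness properties of the Navier–Stokes global regularity
  problem*, Anal. PDE 6 (2013) 25–107 = arXiv:1108.1165 (`Tao2011`): §4, Lemma 4.1 (i) and its
  proof ("Lemma 25", pp. 14–15 of the arXiv text; the duality sentence on p. 15), (35), (42).
* E. M. Stein, *Singular integrals and differentiability properties of functions* (1970)
  (`Stein1971`): Ch. II §4, Ch. III §1 (truncated singular integrals, the Riesz transforms).
* L. C. Evans, *Partial Differential Equations*, 2nd ed. (2010) (`Evans2010`): App. C.4, Thm. 7
  (properties of mollifiers).
-/

noncomputable section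

open MeasureTheory Set Filter Metric Topology Function ContinuousLinearMap
open scoped ENNReal NNReal RealInnerProductSpace ContDiff Convolution

namespace Literature.Analysis.FluidPDE

/-! ## §1. Energy bookkeeping -/

section Energy

variable {v : EuclideanSpace ℝ (Fin 3) → EuclideanSpace ℝ (Fin 3)}

/-- `∫⁻ ‖f‖ₑ² = ‖f‖_{L²}²`. [folklore] -/
theorem lintegral_enorm_pow_two_eq_eLpNorm_sq
    (f : EuclideanSpace ℝ (Fin 3) → EuclideanSpace ℝ (Fin 3)) :
    ∫⁻ x, ‖f x‖ₑ ^ 2 = eLpNorm f 2 volume ^ 2 := by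
  have h := eLpNorm_nnreal_pow_eq_lintegral (f := f)
    (μ := (volume : Measure (EuclideanSpace ℝ (Fin 3)))) (p := (2 : ℝ≥0)) two_ne_zero
  simp only [ENNReal.coe_ofNat, NNReal.coe_ofNat, ENNReal.rpow_two] at h
  exact h.symm

/-- The real energy is the `toReal` of the `ℝ≥0∞` energy. [folklore] -/
theorem integral_norm_sq_eq_toReal (hv2 : Integrable fun y => ‖v y‖ ^ 2) :
    ∫ y, ‖v y‖ ^ 2 = (∫⁻ y, ‖v y‖ₑ ^ 2).toReal := by
  rw [← ofReal_integral_norm_sq_eq_lintegral hv2, ENNReal.toReal_ofReal]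
  exact integral_nonneg fun y => sq_nonneg _

/-- A continuous field of finite energy is in `L²`. [folklore] -/
theorem memLp_two_of_lintegral_enorm_sq_lt_top (hv : Continuous v) (hE : (∫⁻ x, ‖v x‖ₑ ^ 2) < ⊤) :
    MemLp v 2 volume :=
  (memLp_two_iff_integrable_sq_norm hv.aestronglyMeasurable).2
    (integrable_sq_of_lintegral_enorm_sq_lt_top hv hE)

/-- **Far-field bound for the truncated singular integral:**
`|∫_{|x-y|>r} K(x-y)(v(y)) dy| ≤ ∫|v|² / (2π r³)` (`|K(z)(a)| ≤ |a|²/(2π|z|³)`). [folklore] -/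
theorem abs_truncatedPressureIntegral_le_energy (hv : Continuous v)
    (hv2 : Integrable fun y => ‖v y‖ ^ 2) (x : EuclideanSpace ℝ (Fin 3)) {r : ℝ} (hr : 0 < r) :
    |truncatedPressureIntegral v x r| ≤ (∫ y, ‖v y‖ ^ 2) / (2 * Real.pi * r ^ 3) := by
  rw [truncatedPressureIntegral]
  have hint := integrableOn_pressureKernel_compl_closedBall hv hv2 x hr
  have hmaj : IntegrableOn (fun y => ‖v y‖ ^ 2 / (2 * Real.pi * r ^ 3)) (closedBall x r)ᶜ :=
    (hv2.div_const _).integrableOn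
  calc |∫ y in (closedBall x r)ᶜ, pressureKernel (x - y) (v y)|
      ≤ ∫ y in (closedBall x r)ᶜ, |pressureKernel (x - y) (v y)| := abs_integral_le_integral_abs
    _ ≤ ∫ y in (closedBall x r)ᶜ, ‖v y‖ ^ 2 / (2 * Real.pi * r ^ 3) := by
        refine setIntegral_mono_on hint.abs hmaj measurableSet_closedBall.compl fun y hy => ?_
        rw [mem_compl_iff, mem_closedBall, not_le, dist_eq_norm, ← norm_neg, neg_sub] at hy
        calc |pressureKernel (x - y) (v y)| ≤ ‖v y‖ ^ 2 / (2 * Real.pi * ‖x - y‖ ^ 3) :=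
              abs_pressureKernel_le _ _
          _ ≤ ‖v y‖ ^ 2 / (2 * Real.pi * r ^ 3) := by gcongr
    _ ≤ ∫ y, ‖v y‖ ^ 2 / (2 * Real.pi * r ^ 3) :=
        setIntegral_le_integral (hv2.div_const _) (Eventually.of_forall fun y => by positivity)
    _ = (∫ y, ‖v y‖ ^ 2) / (2 * Real.pi * r ^ 3) := integral_div _ _

end Energy

/-! ## §2. Uniform control of the principal values -/

section PV

variable {v : EuclideanSpace ℝ (Fin 3) → EuclideanSpace ℝ (Fin 3)} {x : EuclideanSpace ℝ (Fin 3)}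
  {M₀ M₁ : ℝ}

/-- **The principal value is within `8 M₀ M₁ ε` of the `ε`-truncation:** for a `C¹` finite-energy
field with `|v| ≤ M₀` and `|v(y) - v(x)| ≤ M₁|y - x|` on `B̄(x, 1)`, and `0 < ε ≤ 1`,
`|p̃[v](x) - (-|v(x)|²/3 + ∫_{|x-y|>ε} K(x-y)(v y) dy)| ≤ 8 M₀ M₁ ε` (the Cauchy estimate of
`NormalisedPressurePV` passed to the limit). [folklore] -/
theorem abs_normalisedPressure_sub_truncated_le (hv : ContDiff ℝ 1 v) (hE : (∫⁻ x, ‖v x‖ₑ ^ 2) < ⊤)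
    (hM₀ : ∀ y ∈ closedBall x 1, ‖v y‖ ≤ M₀)
    (hM₁ : ∀ y ∈ closedBall x 1, ‖v y - v x‖ ≤ M₁ * ‖y - x‖) (hM₁0 : 0 ≤ M₁)
    {ε : ℝ} (hε : 0 < ε) (hε1 : ε ≤ 1) :
    |normalisedPressure v x - (-‖v x‖ ^ 2 / 3 + truncatedPressureIntegral v x ε)| ≤
      8 * M₀ * M₁ * ε := by
  have hv2 : Integrable fun y => ‖v y‖ ^ 2 :=
    integrable_sq_of_lintegral_enorm_sq_lt_top hv.continuous hE
  have hM₀0 : 0 ≤ M₀ := (norm_nonneg _).trans (hM₀ x (mem_closedBall_self zero_le_one))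
  obtain ⟨L, hL, hpx⟩ := normalisedPressure_eq_of_contDiff hv hE x
  set T := truncatedPressureIntegral v x with hT
  have hlim : Tendsto (fun δ => |T δ - T ε|) (𝓝[>] 0) (𝓝 |L - T ε|) :=
    (continuous_abs.tendsto _).comp (hL.2.sub tendsto_const_nhds)
  have hLT : |L - T ε| ≤ 8 * M₀ * M₁ * ε := by
    refine le_of_tendsto hlim ?_
    filter_upwards [Ioc_mem_nhdsGT hε] with δ hδ
    calc |T δ - T ε| ≤ 8 * M₀ * M₁ * (ε - δ) :=
          abs_truncatedPressureIntegral_sub_le hv hv2 hM₀ hM₁ hM₁0 hδ.1 hδ.2 hε1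
      _ ≤ 8 * M₀ * M₁ * ε :=
          mul_le_mul_of_nonneg_left (by linarith [hδ.1]) (by positivity)
  rw [hpx]
  calc |-‖v x‖ ^ 2 / 3 + L - (-‖v x‖ ^ 2 / 3 + T ε)| = |L - T ε| := by ring_nf
    _ ≤ 8 * M₀ * M₁ * ε := hLT

/-- **Uniform bound for the normalised pressure:** under the same local bounds,
`|p̃[v](x)| ≤ M₀²/3 + 8 M₀ M₁ + ∫|v|²/(2π)`. [folklore] -/
theorem abs_normalisedPressure_le (hv : ContDiff ℝ 1 v) (hE : (∫⁻ x, ‖v x‖ₑ ^ 2) < ⊤)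
    (hM₀ : ∀ y ∈ closedBall x 1, ‖v y‖ ≤ M₀)
    (hM₁ : ∀ y ∈ closedBall x 1, ‖v y - v x‖ ≤ M₁ * ‖y - x‖) (hM₁0 : 0 ≤ M₁) :
    |normalisedPressure v x| ≤ M₀ ^ 2 / 3 + 8 * M₀ * M₁ + (∫ y, ‖v y‖ ^ 2) / (2 * Real.pi) := by
  have hv2 : Integrable fun y => ‖v y‖ ^ 2 :=
    integrable_sq_of_lintegral_enorm_sq_lt_top hv.continuous hE
  have h1 := abs_normalisedPressure_sub_truncated_le hv hE hM₀ hM₁ hM₁0 one_pos le_rfl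
  have h2 := abs_truncatedPressureIntegral_le_energy hv.continuous hv2 x one_pos
  rw [one_pow, mul_one] at h2
  have h3 : ‖v x‖ ≤ M₀ := hM₀ x (mem_closedBall_self zero_le_one)
  have h4 : |(-‖v x‖ ^ 2 / 3 : ℝ)| ≤ M₀ ^ 2 / 3 := by
    rw [abs_div, abs_neg, abs_pow, abs_norm, abs_of_pos (by norm_num : (0 : ℝ) < 3)]
    gcongr
  calc |normalisedPressure v x|
      = |(normalisedPressure v x - (-‖v x‖ ^ 2 / 3 + truncatedPressureIntegral v x 1)) +
          (-‖v x‖ ^ 2 / 3) + truncatedPressureIntegral v x 1| := by ring_nf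
    _ ≤ |normalisedPressure v x - (-‖v x‖ ^ 2 / 3 + truncatedPressureIntegral v x 1)| +
          |(-‖v x‖ ^ 2 / 3 : ℝ)| + |truncatedPressureIntegral v x 1| :=
        (abs_add_le _ _).trans (add_le_add (abs_add_le _ _) le_rfl)
    _ ≤ 8 * M₀ * M₁ * 1 + M₀ ^ 2 / 3 + (∫ y, ‖v y‖ ^ 2) / (2 * Real.pi) :=
        add_le_add (add_le_add h1 h4) h2
    _ = M₀ ^ 2 / 3 + 8 * M₀ * M₁ + (∫ y, ‖v y‖ ^ 2) / (2 * Real.pi) := by ring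

end PV

/-! ## §3. Mollification of a `C¹` finite-energy field -/

section Mollify

variable {v : EuclideanSpace ℝ (Fin 3) → EuclideanSpace ℝ (Fin 3)}

/-- A mollifier sequence with outer radii `1/(n+1) ≤ 1` tending to `0`. [folklore] -/
theorem exists_contDiffBump_seq_le_one :
    ∃ φ : ℕ → ContDiffBump (0 : EuclideanSpace ℝ (Fin 3)),
      Tendsto (fun n => (φ n).rOut) atTop (𝓝 0) ∧ ∀ n, (φ n).rOut ≤ 1 := by
  refine ⟨fun n => ⟨1 / ((n : ℝ) + 2), 1 / ((n : ℝ) + 1), by positivity, ?_⟩, ?_, fun n => ?_⟩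
  · exact one_div_lt_one_div_of_lt (by positivity) (by linarith)
  · exact tendsto_one_div_add_atTop_nhds_zero_nat
  · change 1 / ((n : ℝ) + 1) ≤ 1
    rw [div_le_one (by positivity)]
    linarith [n.cast_nonneg (α := ℝ)]

/-- The mollification of a continuous field is smooth. [folklore] -/
theorem contDiff_normed_convolution (φ : ContDiffBump (0 : EuclideanSpace ℝ (Fin 3)))
    (hv : Continuous v) {n : ℕ∞} :
    ContDiff ℝ n (φ.normed volume ⋆[lsmul ℝ ℝ, volume] v) :=
  φ.hasCompactSupport_normed.contDiff_convolution_left _ φ.contDiff_normed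
    (hv.locallyIntegrable (μ := volume))

/-- The mollification of a continuous field is continuous. [folklore] -/
theorem continuous_normed_convolution (φ : ContDiffBump (0 : EuclideanSpace ℝ (Fin 3)))
    (hv : Continuous v) :
    Continuous (φ.normed volume ⋆[lsmul ℝ ℝ, volume] v) :=
  φ.hasCompactSupport_normed.continuous_convolution_left _ φ.continuous_normed
    (hv.locallyIntegrable (μ := volume))

/-- **Mollification does not increase the energy** (Young / Jensen with a unit-mass kernel).
[folklore] -/
theorem lintegral_normed_convolution_le (φ : ContDiffBump (0 : EuclideanSpace ℝ (Fin 3)))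
    (hv : Continuous v) :
    (∫⁻ x, ‖(φ.normed volume ⋆[lsmul ℝ ℝ, volume] v) x‖ₑ ^ 2) ≤ ∫⁻ x, ‖v x‖ₑ ^ 2 := by
  rw [lintegral_enorm_pow_two_eq_eLpNorm_sq, lintegral_enorm_pow_two_eq_eLpNorm_sq]
  gcongr
  exact FunctionSpaces.eLpNorm_normed_convolution_le φ hv.aestronglyMeasurable one_le_two

/-- Real form of the energy contraction, for a finite-energy field. [folklore] -/
theorem integral_normed_convolution_le (φ : ContDiffBump (0 : EuclideanSpace ℝ (Fin 3)))
    (hv : Continuous v) (hE : (∫⁻ x, ‖v x‖ₑ ^ 2) < ⊤) :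
    ∫ x, ‖(φ.normed volume ⋆[lsmul ℝ ℝ, volume] v) x‖ ^ 2 ≤ ∫ x, ‖v x‖ ^ 2 := by
  have h1 := lintegral_normed_convolution_le φ hv
  have hv2 : Integrable fun y => ‖v y‖ ^ 2 := integrable_sq_of_lintegral_enorm_sq_lt_top hv hE
  have hw2 : Integrable fun y => ‖(φ.normed volume ⋆[lsmul ℝ ℝ, volume] v) y‖ ^ 2 :=
    integrable_sq_of_lintegral_enorm_sq_lt_top (continuous_normed_convolution φ hv)
      (h1.trans_lt hE)
  rw [integral_norm_sq_eq_toReal hv2, integral_norm_sq_eq_toReal hw2]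
  exact ENNReal.toReal_mono hE.ne h1

/-- **Local sup bound:** if `|v| ≤ M` on the ball `B(y, rOut)` then `|(φ ⋆ v)(y)| ≤ M`
(the kernel is a probability density supported in `B(0, rOut)`). [folklore] -/
theorem norm_normed_convolution_le_of_forall_mem_ball
    (φ : ContDiffBump (0 : EuclideanSpace ℝ (Fin 3))) (hv : Continuous v)
    {y : EuclideanSpace ℝ (Fin 3)} {M : ℝ} (hM0 : 0 ≤ M) (hM : ∀ z ∈ ball y φ.rOut, ‖v z‖ ≤ M) :
    ‖(φ.normed volume ⋆[lsmul ℝ ℝ, volume] v) y‖ ≤ M := by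
  have h := dist_convolution_le (μ := (volume : Measure (EuclideanSpace ℝ (Fin 3))))
    (z₀ := (0 : EuclideanSpace ℝ (Fin 3))) hM0
    φ.support_normed_eq.subset φ.nonneg_normed φ.integral_normed hv.aestronglyMeasurable
    (fun z hz => by simpa only [dist_zero_right] using hM z hz)
  simpa only [dist_zero_right] using h

/-- **Local Lipschitz bound:** if `‖Dv‖ ≤ M₁` on a convex set `B` containing `y - t` and `x - t`
for all `|t| < rOut`, then `|(φ ⋆ v)(y) - (φ ⋆ v)(x)| ≤ M₁ |y - x|` (translate under the
integral and use the mean value inequality). [folklore] -/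
theorem norm_normed_convolution_sub_le (φ : ContDiffBump (0 : EuclideanSpace ℝ (Fin 3)))
    (hv : ContDiff ℝ 1 v) {B : Set (EuclideanSpace ℝ (Fin 3))} (hB : Convex ℝ B) {M₁ : ℝ}
    (hM₁ : ∀ z ∈ B, ‖fderiv ℝ v z‖ ≤ M₁) {x y : EuclideanSpace ℝ (Fin 3)}
    (hxB : ∀ t ∈ ball (0 : EuclideanSpace ℝ (Fin 3)) φ.rOut, x - t ∈ B)
    (hyB : ∀ t ∈ ball (0 : EuclideanSpace ℝ (Fin 3)) φ.rOut, y - t ∈ B) :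
    ‖(φ.normed volume ⋆[lsmul ℝ ℝ, volume] v) y - (φ.normed volume ⋆[lsmul ℝ ℝ, volume] v) x‖ ≤
      M₁ * ‖y - x‖ := by
  have hvc : Continuous v := hv.continuous
  have hint : ∀ p : EuclideanSpace ℝ (Fin 3),
      Integrable (fun t => φ.normed volume t • v (p - t)) volume := fun p =>
    (φ.continuous_normed.smul
      (hvc.comp (continuous_const.sub continuous_id))).integrable_of_hasCompactSupport
      φ.hasCompactSupport_normed.smul_right
  rw [convolution_lsmul, convolution_lsmul, ← integral_sub (hint y) (hint x)]
  have hpt : ∀ t, ‖φ.normed volume t • v (y - t) - φ.normed volume t • v (x - t)‖ ≤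
      φ.normed volume t * (M₁ * ‖y - x‖) := by
    intro t
    rw [← smul_sub, norm_smul, Real.norm_of_nonneg (φ.nonneg_normed t)]
    by_cases ht : t ∈ ball (0 : EuclideanSpace ℝ (Fin 3)) φ.rOut
    · refine mul_le_mul_of_nonneg_left ?_ (φ.nonneg_normed t)
      have h := hB.norm_image_sub_le_of_norm_fderiv_le
        (fun z _ => (hv.differentiable one_ne_zero z)) hM₁ (hxB t ht) (hyB t ht)
      rwa [show y - t - (x - t) = y - x by abel] at h
    · have h0 : φ.normed volume t = 0 := by
        rw [← notMem_support, φ.support_normed_eq]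
        exact ht
      rw [h0, zero_mul, zero_mul]
  calc ‖∫ t, (φ.normed volume t • v (y - t) - φ.normed volume t • v (x - t))‖
      ≤ ∫ t, φ.normed volume t * (M₁ * ‖y - x‖) :=
        norm_integral_le_of_norm_le (φ.integrable_normed.mul_const _) (Eventually.of_forall hpt)
    _ = M₁ * ‖y - x‖ := by rw [integral_mul_const, φ.integral_normed, one_mul]

/-- **Local bounds on the unit ball, uniformly along the mollification.** If `|v| ≤ M₀` and
`‖Dv‖ ≤ M₁` on a convex set `B` containing `y - t` for all `y ∈ B̄(x, 1)`, `|t| < 1`, then for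
every bump `φ` with `rOut ≤ 1` the mollified field satisfies `|φ ⋆ v| ≤ M₀` and
`|(φ ⋆ v)(y) - (φ ⋆ v)(x)| ≤ M₁|y - x|` on `B̄(x, 1)`. [folklore] -/
theorem local_bounds_normed_convolution (φ : ContDiffBump (0 : EuclideanSpace ℝ (Fin 3)))
    (hφ1 : φ.rOut ≤ 1) (hv : ContDiff ℝ 1 v) {B : Set (EuclideanSpace ℝ (Fin 3))} (hB : Convex ℝ B)
    {M₀ M₁ : ℝ} (hM₀0 : 0 ≤ M₀)
    (hM₀ : ∀ z ∈ B, ‖v z‖ ≤ M₀) (hM₁ : ∀ z ∈ B, ‖fderiv ℝ v z‖ ≤ M₁) {x : EuclideanSpace ℝ (Fin 3)}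
    (hx : ∀ y ∈ closedBall x 1, ∀ t ∈ ball (0 : EuclideanSpace ℝ (Fin 3)) 1, y - t ∈ B) :
    (∀ y ∈ closedBall x 1, ‖(φ.normed volume ⋆[lsmul ℝ ℝ, volume] v) y‖ ≤ M₀) ∧
      ∀ y ∈ closedBall x 1,
        ‖(φ.normed volume ⋆[lsmul ℝ ℝ, volume] v) y - (φ.normed volume ⋆[lsmul ℝ ℝ, volume] v) x‖ ≤
          M₁ * ‖y - x‖ := by
  have hball : ∀ t ∈ ball (0 : EuclideanSpace ℝ (Fin 3)) φ.rOut,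
      t ∈ ball (0 : EuclideanSpace ℝ (Fin 3)) 1 := fun t ht =>
    mem_ball_zero_iff.2 ((mem_ball_zero_iff.1 ht).trans_le hφ1)
  have hxmem : x ∈ closedBall x 1 := mem_closedBall_self zero_le_one
  refine ⟨fun y hy => ?_, fun y hy => ?_⟩
  · refine norm_normed_convolution_le_of_forall_mem_ball φ hv.continuous hM₀0 fun z hz => ?_
    have ht : y - z ∈ ball (0 : EuclideanSpace ℝ (Fin 3)) φ.rOut := by
      rw [mem_ball_zero_iff, ← dist_eq_norm, dist_comm]
      exact mem_ball.1 hz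
    have h := hx y hy (y - z) (hball _ ht)
    rw [sub_sub_cancel] at h
    exact hM₀ z h
  · exact norm_normed_convolution_sub_le φ hv hB hM₁ (fun t ht => hx x hxmem t (hball t ht))
      (fun t ht => hx y hy t (hball t ht))

end Mollify

/-! ## §4. Convergence of the truncated singular integrals along the mollification -/

section Truncated

variable {v : EuclideanSpace ℝ (Fin 3) → EuclideanSpace ℝ (Fin 3)}

/-- Weighted AM–GM: `(a + b) c ≤ θ (a² + b²) + c²/(2θ)` for `θ > 0`. [folklore] -/
theorem add_mul_le_mul_sq_add_sq_div {a b c θ : ℝ} (hθ : 0 < θ) :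
    (a + b) * c ≤ θ * (a ^ 2 + b ^ 2) + c ^ 2 / (2 * θ) := by
  have h2θ : 0 < 2 * θ := by positivity
  have key : (a + b) * c * (2 * θ) ≤ θ * (a ^ 2 + b ^ 2) * (2 * θ) + c ^ 2 := by
    nlinarith [sq_nonneg (θ * (a + b) - c), sq_nonneg (θ * (a - b))]
  calc (a + b) * c = (a + b) * c * (2 * θ) / (2 * θ) := (mul_div_cancel_right₀ _ h2θ.ne').symm
    _ ≤ (θ * (a ^ 2 + b ^ 2) * (2 * θ) + c ^ 2) / (2 * θ) :=
        div_le_div_of_nonneg_right key h2θ.le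
    _ = θ * (a ^ 2 + b ^ 2) + c ^ 2 / (2 * θ) := by
        rw [add_div, mul_div_cancel_right₀ _ h2θ.ne']

/-- The squared `L²` distance between the mollification and the field tends to zero
(mollification converges in `L²`, `FunctionSpaces.tendsto_eLpNorm_normed_convolution_sub_self`).
[folklore] -/
theorem tendsto_integral_norm_sub_sq (hv : Continuous v) (hE : (∫⁻ x, ‖v x‖ₑ ^ 2) < ⊤)
    {φ : ℕ → ContDiffBump (0 : EuclideanSpace ℝ (Fin 3))}
    (hφ : Tendsto (fun n => (φ n).rOut) atTop (𝓝 0)) :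
    Tendsto (fun n => ∫ y, ‖(((φ n).normed volume ⋆[lsmul ℝ ℝ, volume] v) y - v y)‖ ^ 2) atTop
      (𝓝 0) := by
  have hvmem : MemLp v 2 volume := memLp_two_of_lintegral_enorm_sq_lt_top hv hE
  have hvnmem : ∀ n, MemLp ((φ n).normed volume ⋆[lsmul ℝ ℝ, volume] v) 2 volume := fun n =>
    FunctionSpaces.memLp_normed_convolution (φ n) hvmem one_le_two
  have hvnc : ∀ n, Continuous ((φ n).normed volume ⋆[lsmul ℝ ℝ, volume] v) := fun n =>
    continuous_normed_convolution (φ n) hv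
  have hDint : ∀ n,
      Integrable fun y => ‖((φ n).normed volume ⋆[lsmul ℝ ℝ, volume] v) y - v y‖ ^ 2 :=
    fun n => (memLp_two_iff_integrable_sq_norm ((hvnc n).sub hv).aestronglyMeasurable).1
      ((hvnmem n).sub hvmem)
  have h1 := FunctionSpaces.tendsto_eLpNorm_normed_convolution_sub_self
    (μ := (volume : Measure (EuclideanSpace ℝ (Fin 3)))) hφ one_le_two ENNReal.ofNat_ne_top hvmem
  have h3 : Tendsto (fun n => eLpNorm ((φ n).normed volume ⋆[lsmul ℝ ℝ, volume] v - v) 2 volume ^ 2)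
      atTop (𝓝 0) := by
    have := ENNReal.Tendsto.pow (n := 2) h1
    rwa [zero_pow two_ne_zero] at this
  have h2 : Tendsto (fun n =>
      (eLpNorm ((φ n).normed volume ⋆[lsmul ℝ ℝ, volume] v - v) 2 volume ^ 2).toReal)
      atTop (𝓝 0) := by
    have := (ENNReal.tendsto_toReal ENNReal.zero_ne_top).comp h3
    rwa [ENNReal.toReal_zero] at this
  refine h2.congr fun n => ?_
  rw [integral_norm_sq_eq_toReal (hDint n), lintegral_enorm_pow_two_eq_eLpNorm_sq]
  rfl

/-- **The truncated singular integrals converge along the mollification:** for fixed `ε > 0`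
and `x`, `∫_{|x-y|>ε} K(x-y)((φₙ ⋆ v)(y)) dy → ∫_{|x-y|>ε} K(x-y)(v(y)) dy` (the kernel is bounded
by `(πε³)⁻¹` there and Lipschitz in the velocity, `|K(z)(b) - K(z)(a)| ≤ (|a|+|b|)|b-a|/(π|z|³)`,
and `φₙ ⋆ v → v` in `L²`). [folklore] -/
theorem tendsto_truncatedPressureIntegral_normed_convolution (hv : Continuous v)
    (hE : (∫⁻ x, ‖v x‖ₑ ^ 2) < ⊤) {φ : ℕ → ContDiffBump (0 : EuclideanSpace ℝ (Fin 3))}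
    (hφ : Tendsto (fun n => (φ n).rOut) atTop (𝓝 0)) (x : EuclideanSpace ℝ (Fin 3)) {ε : ℝ}
    (hε : 0 < ε) :
    Tendsto (fun n => truncatedPressureIntegral ((φ n).normed volume ⋆[lsmul ℝ ℝ, volume] v) x ε)
      atTop (𝓝 (truncatedPressureIntegral v x ε)) := by
  set vn : ℕ → EuclideanSpace ℝ (Fin 3) → EuclideanSpace ℝ (Fin 3) :=
    fun n => (φ n).normed volume ⋆[lsmul ℝ ℝ, volume] v with hvn
  have hv2 : Integrable fun y => ‖v y‖ ^ 2 := integrable_sq_of_lintegral_enorm_sq_lt_top hv hE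
  have hvnc : ∀ n, Continuous (vn n) := fun n => continuous_normed_convolution (φ n) hv
  have hvnE : ∀ n, (∫⁻ y, ‖vn n y‖ₑ ^ 2) < ⊤ := fun n =>
    (lintegral_normed_convolution_le (φ n) hv).trans_lt hE
  have hvn2 : ∀ n, Integrable fun y => ‖vn n y‖ ^ 2 := fun n =>
    integrable_sq_of_lintegral_enorm_sq_lt_top (hvnc n) (hvnE n)
  have hvn2le : ∀ n, ∫ y, ‖vn n y‖ ^ 2 ≤ ∫ y, ‖v y‖ ^ 2 := fun n =>
    integral_normed_convolution_le (φ n) hv hE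
  have hvmem : MemLp v 2 volume := memLp_two_of_lintegral_enorm_sq_lt_top hv hE
  have hvnmem : ∀ n, MemLp (vn n) 2 volume := fun n =>
    FunctionSpaces.memLp_normed_convolution (φ n) hvmem one_le_two
  have hDint : ∀ n, Integrable fun y => ‖vn n y - v y‖ ^ 2 := fun n =>
    (memLp_two_iff_integrable_sq_norm ((hvnc n).sub hv).aestronglyMeasurable).1
      ((hvnmem n).sub hvmem)
  have hD : Tendsto (fun n => ∫ y, ‖vn n y - v y‖ ^ 2) atTop (𝓝 0) :=
    tendsto_integral_norm_sub_sq hv hE hφ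
  -- constants
  set E := ∫ y, ‖v y‖ ^ 2 with hEdef
  have hE0 : 0 ≤ E := integral_nonneg fun y => sq_nonneg _
  set c : ℝ := (Real.pi * ε ^ 3)⁻¹ with hc
  have hc0 : 0 < c := by positivity
  -- the core estimate
  have key : ∀ n, ∀ θ : ℝ, 0 < θ →
      |truncatedPressureIntegral (vn n) x ε - truncatedPressureIntegral v x ε| ≤
        c * (θ * (E + E) + (∫ y, ‖vn n y - v y‖ ^ 2) / (2 * θ)) := by
    intro n θ hθ
    set S : Set (EuclideanSpace ℝ (Fin 3)) := (closedBall x ε)ᶜ with hS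
    have hSm : MeasurableSet S := measurableSet_closedBall.compl
    have hiv : IntegrableOn (fun y => pressureKernel (x - y) (v y)) S :=
      integrableOn_pressureKernel_compl_closedBall hv hv2 x hε
    have hivn : IntegrableOn (fun y => pressureKernel (x - y) (vn n y)) S :=
      integrableOn_pressureKernel_compl_closedBall (hvnc n) (hvn2 n) x hε
    set g : EuclideanSpace ℝ (Fin 3) → ℝ := fun y =>
      c * (θ * (‖v y‖ ^ 2 + ‖vn n y‖ ^ 2) + ‖vn n y - v y‖ ^ 2 / (2 * θ)) with hg
    have hgi : Integrable g :=
      (((hv2.add (hvn2 n)).const_mul θ).add ((hDint n).div_const (2 * θ))).const_mul c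
    have hg0 : ∀ y, 0 ≤ g y := fun y => by positivity
    have hbound : ∀ y ∈ S,
        ‖pressureKernel (x - y) (vn n y) - pressureKernel (x - y) (v y)‖ ≤ g y := by
      intro y hy
      rw [hS, mem_compl_iff, mem_closedBall, not_le, dist_eq_norm, ← norm_neg, neg_sub] at hy
      rw [Real.norm_eq_abs]
      have hnum : 0 ≤ (‖v y‖ + ‖vn n y‖) * ‖vn n y - v y‖ := by positivity
      calc |pressureKernel (x - y) (vn n y) - pressureKernel (x - y) (v y)|
          ≤ (‖v y‖ + ‖vn n y‖) * ‖vn n y - v y‖ / (Real.pi * ‖x - y‖ ^ 3) :=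
            abs_pressureKernel_sub_le _ _ _
        _ ≤ (‖v y‖ + ‖vn n y‖) * ‖vn n y - v y‖ / (Real.pi * ε ^ 3) := by
            gcongr
        _ = c * ((‖v y‖ + ‖vn n y‖) * ‖vn n y - v y‖) := by rw [hc, div_eq_inv_mul]
        _ ≤ c * (θ * (‖v y‖ ^ 2 + ‖vn n y‖ ^ 2) + ‖vn n y - v y‖ ^ 2 / (2 * θ)) :=
            mul_le_mul_of_nonneg_left (add_mul_le_mul_sq_add_sq_div hθ) hc0.le
        _ = g y := rfl
    calc |truncatedPressureIntegral (vn n) x ε - truncatedPressureIntegral v x ε|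
        = ‖∫ y in S, (pressureKernel (x - y) (vn n y) - pressureKernel (x - y) (v y))‖ := by
          rw [truncatedPressureIntegral, truncatedPressureIntegral, ← integral_sub hivn hiv,
            Real.norm_eq_abs]
      _ ≤ ∫ y in S, g y := norm_integral_le_of_norm_le hgi.integrableOn
            ((ae_restrict_iff' hSm).2 (Eventually.of_forall hbound))
      _ ≤ ∫ y, g y := setIntegral_le_integral hgi (Eventually.of_forall hg0)
      _ = c * (θ * (E + ∫ y, ‖vn n y‖ ^ 2) + (∫ y, ‖vn n y - v y‖ ^ 2) / (2 * θ)) := by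
          have i1 : Integrable fun y => θ * (‖v y‖ ^ 2 + ‖vn n y‖ ^ 2) :=
            (hv2.add (hvn2 n)).const_mul θ
          have i2 : Integrable fun y => ‖vn n y - v y‖ ^ 2 / (2 * θ) := (hDint n).div_const _
          rw [hg, integral_const_mul, integral_add i1 i2, integral_const_mul,
            integral_add hv2 (hvn2 n), integral_div]
      _ ≤ c * (θ * (E + E) + (∫ y, ‖vn n y - v y‖ ^ 2) / (2 * θ)) := by
          gcongr
          exact hvn2le n
  -- conclusion
  rw [Metric.tendsto_nhds]
  intro η hη
  set θ : ℝ := η / (4 * c * E + 1) with hθ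
  have hθ0 : 0 < θ := by positivity
  have hfirst : c * (θ * (E + E)) ≤ η / 2 := by
    rw [hθ]
    rw [show c * (η / (4 * c * E + 1) * (E + E)) = (2 * c * E * η) / (4 * c * E + 1) by ring,
      div_le_div_iff₀ (by positivity) (by positivity)]
    nlinarith [mul_nonneg hc0.le hE0]
  have hsecond : ∀ᶠ n in atTop, c * ((∫ y, ‖vn n y - v y‖ ^ 2) / (2 * θ)) < η / 2 := by
    have h := (hD.div_const (2 * θ)).const_mul c
    rw [zero_div, mul_zero] at h
    exact h.eventually (gt_mem_nhds (half_pos hη))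
  filter_upwards [hsecond] with n hn
  rw [Real.dist_eq]
  calc |truncatedPressureIntegral (vn n) x ε - truncatedPressureIntegral v x ε|
      ≤ c * (θ * (E + E) + (∫ y, ‖vn n y - v y‖ ^ 2) / (2 * θ)) := key n θ hθ0
    _ = c * (θ * (E + E)) + c * ((∫ y, ‖vn n y - v y‖ ^ 2) / (2 * θ)) := by ring
    _ < η / 2 + η / 2 := add_lt_add_of_le_of_lt hfirst hn
    _ = η := by ring

end Truncated

/-! ## §5. Pointwise convergence of the normalised pressures -/

section Pointwise

variable {v : EuclideanSpace ℝ (Fin 3) → EuclideanSpace ℝ (Fin 3)}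

/-- A real-variable `3ε` lemma: if `fₙ` and `f₀` are approximated within `Cε` by `aₙ(ε)`, `a₀(ε)`
for every `0 < ε ≤ 1`, and `aₙ(ε) → a₀(ε)` for each such `ε`, then `fₙ → f₀`. [folklore] -/
theorem tendsto_of_forall_abs_sub_le {f : ℕ → ℝ} {f₀ : ℝ} {a : ℝ → ℕ → ℝ} {a₀ : ℝ → ℝ} {C : ℝ}
    (hf : ∀ ε ∈ Ioc (0 : ℝ) 1, ∀ n, |f n - a ε n| ≤ C * ε)
    (hf₀ : ∀ ε ∈ Ioc (0 : ℝ) 1, |f₀ - a₀ ε| ≤ C * ε)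
    (ha : ∀ ε ∈ Ioc (0 : ℝ) 1, Tendsto (a ε) atTop (𝓝 (a₀ ε))) :
    Tendsto f atTop (𝓝 f₀) := by
  have hC : 0 ≤ C := by
    have h := hf₀ 1 ⟨one_pos, le_rfl⟩
    rw [mul_one] at h
    exact (abs_nonneg _).trans h
  rw [Metric.tendsto_nhds]
  intro η hη
  set ε : ℝ := min 1 (η / (3 * C + 1)) with hεdef
  have hε0 : 0 < ε := lt_min one_pos (by positivity)
  have hε1 : ε ≤ 1 := min_le_left _ _
  have hCε : C * ε < η / 3 := by
    calc C * ε ≤ C * (η / (3 * C + 1)) := mul_le_mul_of_nonneg_left (min_le_right _ _) hC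
      _ < η / 3 := by
          rw [mul_div_assoc', div_lt_div_iff₀ (by positivity) (by positivity)]
          nlinarith
  have hmem : ε ∈ Ioc (0 : ℝ) 1 := ⟨hε0, hε1⟩
  have hev : ∀ᶠ n in atTop, dist (a ε n) (a₀ ε) < η / 3 :=
    Metric.tendsto_nhds.1 (ha ε hmem) _ (by positivity)
  filter_upwards [hev] with n hn
  rw [Real.dist_eq] at hn ⊢
  have h1 := hf ε hmem n
  have h3 : |a₀ ε - f₀| ≤ C * ε := by rw [abs_sub_comm]; exact hf₀ ε hmem
  calc |f n - f₀| = |(f n - a ε n) + (a ε n - a₀ ε) + (a₀ ε - f₀)| := by ring_nf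
    _ ≤ |f n - a ε n| + |a ε n - a₀ ε| + |a₀ ε - f₀| := abs_add_three _ _ _
    _ < η / 3 + η / 3 + η / 3 := by linarith
    _ = η := by ring

/-- **Pointwise convergence of the normalised pressures along the mollification.** Let `v` be
`C¹` with finite energy, `φₙ` bumps with `rOut ≤ 1`, `rOut → 0`, and suppose `|v| ≤ M₀`,
`‖Dv‖ ≤ M₁` on a convex set `B` containing `B̄(x, 1) - B(0, 1)`. Then
`p̃[φₙ ⋆ v](x) → p̃[v](x)`: the principal values of `v` and of all `φₙ ⋆ v` are within
`8M₀M₁ε` of their `ε`-truncations (uniformly in `n`), the `ε`-truncations converge, and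
`(φₙ ⋆ v)(x) → v(x)`. [folklore] -/
theorem tendsto_normalisedPressure_normed_convolution (hv : ContDiff ℝ 1 v)
    (hE : (∫⁻ x, ‖v x‖ₑ ^ 2) < ⊤) {φ : ℕ → ContDiffBump (0 : EuclideanSpace ℝ (Fin 3))}
    (hφ : Tendsto (fun n => (φ n).rOut) atTop (𝓝 0)) (hφ1 : ∀ n, (φ n).rOut ≤ 1)
    {B : Set (EuclideanSpace ℝ (Fin 3))} (hB : Convex ℝ B) {M₀ M₁ : ℝ} (hM₀0 : 0 ≤ M₀)
    (hM₁0 : 0 ≤ M₁)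
    (hM₀ : ∀ z ∈ B, ‖v z‖ ≤ M₀) (hM₁ : ∀ z ∈ B, ‖fderiv ℝ v z‖ ≤ M₁) {x : EuclideanSpace ℝ (Fin 3)}
    (hx : ∀ y ∈ closedBall x 1, ∀ t ∈ ball (0 : EuclideanSpace ℝ (Fin 3)) 1, y - t ∈ B) :
    Tendsto (fun n => normalisedPressure ((φ n).normed volume ⋆[lsmul ℝ ℝ, volume] v) x) atTop
      (𝓝 (normalisedPressure v x)) := by
  set vn : ℕ → EuclideanSpace ℝ (Fin 3) → EuclideanSpace ℝ (Fin 3) :=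
    fun n => (φ n).normed volume ⋆[lsmul ℝ ℝ, volume] v with hvn
  have hvc : Continuous v := hv.continuous
  have hvn1 : ∀ n, ContDiff ℝ 1 (vn n) := fun n => contDiff_normed_convolution (φ n) hvc
  have hvnE : ∀ n, (∫⁻ y, ‖vn n y‖ₑ ^ 2) < ⊤ := fun n =>
    (lintegral_normed_convolution_le (φ n) hvc).trans_lt hE
  -- local bounds for `v` on the unit ball
  have hxmem : x ∈ closedBall x 1 := mem_closedBall_self zero_le_one
  have hsub : ∀ y ∈ closedBall x 1, y ∈ B := fun y hy => by
    simpa using hx y hy 0 (mem_ball_self one_pos)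
  have hvM₀ : ∀ y ∈ closedBall x 1, ‖v y‖ ≤ M₀ := fun y hy => hM₀ y (hsub y hy)
  have hvM₁ : ∀ y ∈ closedBall x 1, ‖v y - v x‖ ≤ M₁ * ‖y - x‖ := fun y hy =>
    hB.norm_image_sub_le_of_norm_fderiv_le (fun z _ => hv.differentiable one_ne_zero z) hM₁
      (hsub x hxmem) (hsub y hy)
  -- local bounds for the mollified fields
  have hloc : ∀ n, (∀ y ∈ closedBall x 1, ‖vn n y‖ ≤ M₀) ∧
      ∀ y ∈ closedBall x 1, ‖vn n y - vn n x‖ ≤ M₁ * ‖y - x‖ := fun n =>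
    local_bounds_normed_convolution (φ n) (hφ1 n) hv hB hM₀0 hM₀ hM₁ hx
  refine tendsto_of_forall_abs_sub_le (C := 8 * M₀ * M₁)
    (a := fun ε n => -‖vn n x‖ ^ 2 / 3 + truncatedPressureIntegral (vn n) x ε)
    (a₀ := fun ε => -‖v x‖ ^ 2 / 3 + truncatedPressureIntegral v x ε) ?_ ?_ ?_
  · intro ε hε n
    exact abs_normalisedPressure_sub_truncated_le (hvn1 n) (hvnE n) (hloc n).1 (hloc n).2 hM₁0
      hε.1 hε.2
  · intro ε hε
    exact abs_normalisedPressure_sub_truncated_le hv hE hvM₀ hvM₁ hM₁0 hε.1 hε.2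
  · intro ε hε
    have h1 : Tendsto (fun n => vn n x) atTop (𝓝 (v x)) :=
      ContDiffBump.convolution_tendsto_right_of_continuous hφ hvc x
    have h2 : Tendsto (fun n => -‖vn n x‖ ^ 2 / 3) atTop (𝓝 (-‖v x‖ ^ 2 / 3)) :=
      ((h1.norm.pow 2).neg.div_const 3)
    exact h2.add (tendsto_truncatedPressureIntegral_normed_convolution hvc hE hφ x hε.1)

end Pointwise

/-! ## §6. The discharge -/

section Discharge

/-- **Discharge of `integral_normalisedPressure_mul_rescaled_le`** (input F2 of
`NormalisedPressureProofs`; Tao 2011, §4, proof of Lemma 4.1 (i): "by an integration by parts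
and (p0-def) … `R⁻⁴∫∫ uᵢuⱼ (∇Δ⁻¹∂ᵢ∂ⱼχ)(x/R)` … from the finite energy nature of `(u,p,u₀,f,T)`
we see that this expression goes to zero as `R → ∞`"). For every `ψ ∈ C_c^∞(ℝ³)` there is
`M` with `|∫ p̃[v](x) ψ(R⁻¹(x - x₀)) dx| ≤ M ∫|v|²` for all `C¹` finite-energy `v`, all `x₀`
and all `R > 0`. Proof: the tree's bound for `C²` fields
(`PressureRepresentation.abs_integral_pressurePotential_mul_le` with
`normalisedPressure_eq_pressurePotential'`) applied to the mollifications `φₙ ⋆ v`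
(`∫|φₙ ⋆ v|² ≤ ∫|v|²`), and dominated convergence on the support of the test function:
`p̃[φₙ ⋆ v] → p̃[v]` pointwise with a uniform bound (§2, §5).
[cite: Tao2011, §4, proof of Lemma 4.1 (i)] -/
theorem integral_normalisedPressure_mul_rescaled_le_holds :
    integral_normalisedPressure_mul_rescaled_le := by
  intro ψ hψ hψc
  obtain ⟨M, hM⟩ := abs_integral_pressurePotential_mul_le (contDiff_infty.1 hψ 2) hψc
  refine ⟨max M 0, fun v hv hE x₀ R hR => ?_⟩
  have hvc : Continuous v := hv.continuous
  have hv2 : Integrable fun y => ‖v y‖ ^ 2 := integrable_sq_of_lintegral_enorm_sq_lt_top hvc hE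
  rw [← integral_norm_sq_eq_toReal hv2]
  set E := ∫ y, ‖v y‖ ^ 2 with hEdef
  have hE0 : 0 ≤ E := integral_nonneg fun y => sq_nonneg _
  -- the dilated test function and its support
  set ψR : EuclideanSpace ℝ (Fin 3) → ℝ := fun x => ψ (R⁻¹ • (x - x₀)) with hψR
  have hψRc : HasCompactSupport ψR := hasCompactSupport_comp_inv_smul_sub hψc hR x₀
  have hψRs : ContDiff ℝ 2 ψR :=
    (contDiff_infty.1 hψ 2).comp ((contDiff_id.sub contDiff_const).const_smul _)
  have hψRcont : Continuous ψR := hψRs.continuous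
  set K : Set (EuclideanSpace ℝ (Fin 3)) := tsupport ψR with hK
  have hKc : IsCompact K := hψRc
  obtain ⟨ρ, hρ⟩ := hKc.isBounded.subset_closedBall (0 : EuclideanSpace ℝ (Fin 3))
  -- a big ball carrying all the local estimates, and the bounds of `v`, `Dv` on it
  set B : Set (EuclideanSpace ℝ (Fin 3)) := closedBall (0 : EuclideanSpace ℝ (Fin 3)) (ρ + 2)
    with hB
  have hBc : IsCompact B := isCompact_closedBall _ _
  have hBconv : Convex ℝ B := convex_closedBall _ _
  obtain ⟨M₀', hM₀'⟩ := hBc.exists_bound_of_continuousOn hvc.continuousOn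
  obtain ⟨M₁', hM₁'⟩ := hBc.exists_bound_of_continuousOn
    (hv.continuous_fderiv one_ne_zero).continuousOn
  set M₀ := max M₀' 0 with hM₀def
  set M₁ := max M₁' 0 with hM₁def
  have hM₀0 : 0 ≤ M₀ := le_max_right _ _
  have hM₁0 : 0 ≤ M₁ := le_max_right _ _
  have hM₀ : ∀ z ∈ B, ‖v z‖ ≤ M₀ := fun z hz => (hM₀' z hz).trans (le_max_left _ _)
  have hM₁ : ∀ z ∈ B, ‖fderiv ℝ v z‖ ≤ M₁ := fun z hz => (hM₁' z hz).trans (le_max_left _ _)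
  have hx : ∀ x ∈ K, ∀ y ∈ closedBall x 1, ∀ t ∈ ball (0 : EuclideanSpace ℝ (Fin 3)) 1,
      y - t ∈ B := by
    intro x hxK y hy t ht
    have h1 : ‖x‖ ≤ ρ := mem_closedBall_zero_iff.1 (hρ hxK)
    rw [mem_closedBall, dist_eq_norm] at hy
    rw [mem_ball_zero_iff] at ht
    rw [hB, mem_closedBall_zero_iff]
    have h2 : ‖y‖ ≤ ‖y - x‖ + ‖x‖ := by
      calc ‖y‖ = ‖(y - x) + x‖ := by rw [sub_add_cancel]
        _ ≤ ‖y - x‖ + ‖x‖ := norm_add_le _ _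
    calc ‖y - t‖ ≤ ‖y‖ + ‖t‖ := norm_sub_le _ _
      _ ≤ (1 + ρ) + 1 := by linarith
      _ = ρ + 2 := by ring
  -- the mollified fields
  obtain ⟨φ, hφ, hφ1⟩ := exists_contDiffBump_seq_le_one
  set vn : ℕ → EuclideanSpace ℝ (Fin 3) → EuclideanSpace ℝ (Fin 3) :=
    fun n => (φ n).normed volume ⋆[lsmul ℝ ℝ, volume] v with hvn
  have hvn1 : ∀ n, ContDiff ℝ 1 (vn n) := fun n => contDiff_normed_convolution (φ n) hvc
  have hvn2' : ∀ n, ContDiff ℝ 2 (vn n) := fun n => contDiff_normed_convolution (φ n) hvc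
  have hvn4 : ∀ n, ContDiff ℝ 4 (vn n) := fun n => contDiff_normed_convolution (φ n) hvc
  have hvnc : ∀ n, Continuous (vn n) := fun n => continuous_normed_convolution (φ n) hvc
  have hvnE : ∀ n, (∫⁻ y, ‖vn n y‖ₑ ^ 2) < ⊤ := fun n =>
    (lintegral_normed_convolution_le (φ n) hvc).trans_lt hE
  have hvnL2 : ∀ n, Integrable fun y => ‖vn n y‖ ^ 2 := fun n =>
    integrable_sq_of_lintegral_enorm_sq_lt_top (hvnc n) (hvnE n)
  have hvnle : ∀ n, ∫ y, ‖vn n y‖ ^ 2 ≤ E := fun n => integral_normed_convolution_le (φ n) hvc hE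
  -- (1) the bound at each stage of the mollification (the `C²` theory of the tree)
  have hstage : ∀ n, |∫ x, normalisedPressure (vn n) x * ψR x| ≤ max M 0 * E := by
    intro n
    rw [normalisedPressure_eq_pressurePotential' (hvn2' n) (hvnL2 n)]
    calc |∫ x, pressurePotential (vn n) x * ψR x| ≤ M * ∫ y, ‖vn n y‖ ^ 2 :=
          hM (vn n) (hvn2' n) (hvnL2 n) x₀ R hR
      _ ≤ max M 0 * ∫ y, ‖vn n y‖ ^ 2 :=
          mul_le_mul_of_nonneg_right (le_max_left _ _) (integral_nonneg fun y => sq_nonneg _)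
      _ ≤ max M 0 * E := mul_le_mul_of_nonneg_left (hvnle n) (le_max_right _ _)
  -- (2) dominated convergence on the support of the test function
  set Cbig : ℝ := M₀ ^ 2 / 3 + 8 * M₀ * M₁ + E / (2 * Real.pi) with hCbig
  have hlim : Tendsto (fun n => ∫ x, normalisedPressure (vn n) x * ψR x) atTop
      (𝓝 (∫ x, normalisedPressure v x * ψR x)) := by
    refine tendsto_integral_of_dominated_convergence (fun x => Cbig * |ψR x|) ?_ ?_ ?_ ?_
    · intro n
      rw [normalisedPressure_eq_pressurePotential' (hvn2' n) (hvnL2 n)]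
      exact ((contDiff_pressurePotential (hvn4 n) (hvnL2 n)).continuous.mul
        hψRcont).aestronglyMeasurable
    · exact (hψRcont.abs.integrable_of_hasCompactSupport hψRc.abs).const_mul _
    · intro n
      refine Eventually.of_forall fun x => ?_
      rw [norm_mul, Real.norm_eq_abs, Real.norm_eq_abs]
      by_cases hxK : x ∈ K
      · refine mul_le_mul_of_nonneg_right ?_ (abs_nonneg _)
        have hb := local_bounds_normed_convolution (φ n) (hφ1 n) hv hBconv hM₀0 hM₀ hM₁
          (hx x hxK)
        calc |normalisedPressure (vn n) x|
            ≤ M₀ ^ 2 / 3 + 8 * M₀ * M₁ + (∫ y, ‖vn n y‖ ^ 2) / (2 * Real.pi) :=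
              abs_normalisedPressure_le (hvn1 n) (hvnE n) hb.1 hb.2 hM₁0
          _ ≤ Cbig := by
              rw [hCbig]
              gcongr
              exact hvnle n
      · have h0 : ψR x = 0 := image_eq_zero_of_notMem_tsupport hxK
        rw [h0, abs_zero, mul_zero, mul_zero]
    · refine Eventually.of_forall fun x => ?_
      by_cases hxK : x ∈ K
      · exact (tendsto_normalisedPressure_normed_convolution hv hE hφ hφ1 hBconv hM₀0 hM₁0 hM₀
          hM₁ (hx x hxK)).mul_const _
      · have h0 : ψR x = 0 := image_eq_zero_of_notMem_tsupport hxK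
        simp only [h0, mul_zero]
        exact tendsto_const_nhds
  -- (3) pass to the limit in the bound
  exact le_of_tendsto' ((continuous_abs.tendsto _).comp hlim) fun n => hstage n

end Discharge

end Literature.Analysis.FluidPDE

end
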